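import Summits.AnomalousDissipation.AnomalousDissipation.Theorems.SolenoidalFractalHomogenisationLagrangianCarrierConstructionTowerSlice
import Summits.AnomalousDissipation.AnomalousDissipation.Theorems.SolenoidalFractalHomogenisationLagrangianCarrierConstructionTowerStepC
import HarnessLib

/-!
# K3L `LagrangianCarrierConstruction` (stmt-AnomalousDissipation-24913), line `birth`: the derivative bounds (L3b), (F1c) of `LevelRegular`
# for one level of the Lagrangian tower (helper; `--supports stmt-AnomalousDissipation-24913`)

Summits-side helper file (everything proved; no definitions, no named facts). In the tower's own terms (absolute flows `A t : ℝᵈ ≃ ℝᵈ`,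
lattice equivariant, jointly `C^n` on one-sided closed time slabs for every `n`):
* (F1c) `exists_bound_iteratedFDeriv_disp`: every space derivative of the lifted displacement `z ↦ A t ((A s)⁻¹ z) − z` is bounded
  uniformly for `t` in any compact interval (joint smoothness on slabs ⇒ slice formula ⇒ periodic continuous ⇒ bounded; finite subcover);
* (L3b) `exists_bound_iteratedFDeriv_inserted`: every space derivative of the lifted inserted level
  `z ↦ D(A t ∘ A(w)⁻¹)(A w ((A t)⁻¹ z)) · v(t, A w ((A t)⁻¹ z))`, `w = ⌊t/R⌋R`, is bounded uniformly in ALL `t`, provided the Eulerian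
  field `v` vanishes at the window boundaries (so that on every small closed one-sided slab the field is a FIXED-frame formula, jointly
  `C^n` by `contDiffOn_fixed_frame`) and the field is time periodic (so that a bound on one period suffices).
Infrastructure for route-1's rung leaf F-D1.A0 (a frontier FORMAL rung); NOT a proof of anomalous dissipation.
-/

set_option linter.dupNamespace false

noncomputable section

namespace Summit.AnomalousDissipation.AnomalousDissipation.Theorems.SolenoidalFractalHomogenisation.LagrangianCarrierConstruction

open Set Function Filter Topology
open scoped ContDiff
open Literature.Analysis Literature.Analysis.FunctionSpaces

variable {d : Type*} [Fintype d] [DecidableEq d]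

/-- The space derivative of a slice through the derivative within a closed slab. [folklore] -/
theorem fderiv_slice_eq_within {V F : Type*} [NormedAddCommGroup V] [NormedSpace ℝ V] [NormedAddCommGroup F] [NormedSpace ℝ F]
    {J : ℝ × V → F} {a b : ℝ} {n : ℕ} (hJ : ContDiffOn ℝ (n + 1) J (Icc a b ×ˢ univ)) {t : ℝ} (ht : t ∈ Icc a b)
    (y : V) : fderiv ℝ (fun y => J (t, y)) y = (fderivWithin ℝ J (Icc a b ×ˢ univ) (t, y)).comp (ContinuousLinearMap.inr ℝ ℝ V) := by
  have hd : DifferentiableWithinAt ℝ J (Icc a b ×ˢ univ) (t, y) :=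
    (hJ (t, y) ⟨ht, mem_univ _⟩).differentiableWithinAt (by simp)
  have h2 : HasFDerivWithinAt (fun y => J (t, y)) ((fderivWithin ℝ J (Icc a b ×ˢ univ) (t, y)).comp (ContinuousLinearMap.inr ℝ ℝ V))
      univ y := by
    have h := hd.hasFDerivWithinAt.comp y ((hasFDerivAt_prodMk_right t y).hasFDerivWithinAt (s := univ))
      (fun y' _ => ⟨ht, mem_univ _⟩)
    exact h
  exact (h2.hasFDerivAt univ_mem).fderiv

omit [DecidableEq d] in
/-- **The fixed-frame formula is jointly `C^n` on a closed slab.** If `(t,z) ↦ A t z` is jointly `C^{n+1}` and `(t,z) ↦ (A t)⁻¹ z` jointly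
`C^n` on `[a,b] × ℝᵈ`, `A s` is a smooth diffeomorphism and `v` is jointly `C^n` there, then so is
`(t, z) ↦ D(A t ∘ (A s)⁻¹)(A s ((A t)⁻¹ z)) · v (t, A s ((A t)⁻¹ z))`. [folklore] -/
theorem contDiffOn_fixed_frame (A : ℝ → EuclideanSpace ℝ d ≃ EuclideanSpace ℝ d) {a b : ℝ} (hab : a < b) {n : ℕ} (s : ℝ)
    (hA : ContDiffOn ℝ (n + 1) (fun p : ℝ × EuclideanSpace ℝ d => A p.1 p.2) (Icc a b ×ˢ univ))
    (hA' : ContDiffOn ℝ n (fun p : ℝ × EuclideanSpace ℝ d => (A p.1).symm p.2) (Icc a b ×ˢ univ))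
    (hs : ContDiff ℝ ∞ (A s)) (hs' : ContDiff ℝ ∞ (A s).symm)
    (v : ℝ → EuclideanSpace ℝ d → EuclideanSpace ℝ d) (hv : ContDiffOn ℝ n (uncurry v) (Icc a b ×ˢ univ)) :
    ContDiffOn ℝ n (fun p : ℝ × EuclideanSpace ℝ d => fderiv ℝ (fun y => A p.1 ((A s).symm y)) (A s ((A p.1).symm p.2))
      (v p.1 (A s ((A p.1).symm p.2)))) (Icc a b ×ˢ univ) := by
  have hSu : UniqueDiffOn ℝ (Icc a b ×ˢ (univ : Set (EuclideanSpace ℝ d))) := (uniqueDiffOn_Icc hab).prod uniqueDiffOn_univ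
  -- the joint map `J (t, y) = A t ((A s)⁻¹ y)` and its derivative within the slab
  have hJ : ContDiffOn ℝ (n + 1) (fun p : ℝ × EuclideanSpace ℝ d => A p.1 ((A s).symm p.2)) (Icc a b ×ˢ univ) :=
    hA.comp (contDiffOn_fst.prodMk ((hs'.of_le (by exact_mod_cast le_top)).comp_contDiffOn contDiffOn_snd))
      fun p hp => ⟨hp.1, mem_univ _⟩
  have hD : ContDiffOn ℝ n (fun p : ℝ × EuclideanSpace ℝ d =>
      (fderivWithin ℝ (fun p : ℝ × EuclideanSpace ℝ d => A p.1 ((A s).symm p.2)) (Icc a b ×ˢ univ) p).comp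
        (ContinuousLinearMap.inr ℝ ℝ (EuclideanSpace ℝ d))) (Icc a b ×ˢ univ) :=
    (hJ.fderivWithin hSu (by exact_mod_cast le_rfl)).clm_comp contDiffOn_const
  -- the pulled-back point `q (t, z) = A s ((A t)⁻¹ z)`
  have hq : ContDiffOn ℝ n (fun p : ℝ × EuclideanSpace ℝ d => A s ((A p.1).symm p.2)) (Icc a b ×ˢ univ) :=
    (hs.of_le (by exact_mod_cast le_top)).comp_contDiffOn hA'
  have hmaps : MapsTo (fun p : ℝ × EuclideanSpace ℝ d => (p.1, A s ((A p.1).symm p.2))) (Icc a b ×ˢ univ) (Icc a b ×ˢ univ) :=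
    fun p hp => ⟨hp.1, mem_univ _⟩
  have hDq := hD.comp (contDiffOn_fst.prodMk hq) hmaps
  have hVq : ContDiffOn ℝ n (fun p : ℝ × EuclideanSpace ℝ d => v p.1 (A s ((A p.1).symm p.2))) (Icc a b ×ˢ univ) :=
    hv.comp (contDiffOn_fst.prodMk hq) hmaps
  refine (hDq.clm_apply hVq).congr fun p hp => ?_
  simp only [comp_apply]
  rw [fderiv_slice_eq_within (J := fun p : ℝ × EuclideanSpace ℝ d => A p.1 ((A s).symm p.2)) hJ hp.1]

/-- **(F1c) for one level: the space derivatives of the lifted displacements are bounded on compact time intervals.** [folklore] -/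
theorem exists_bound_iteratedFDeriv_disp (A : ℝ → EuclideanSpace ℝ d ≃ EuclideanSpace ℝ d)
    (h1 : ∀ t z (k : d → ℤ), A t (z + Torus.latticeVec k) = A t z + Torus.latticeVec k)
    (h3 : ∀ (n : ℕ), 1 ≤ n → ∀ r, ∃ ε > 0, ContDiffOn ℝ n (fun p : ℝ × EuclideanSpace ℝ d => A p.1 p.2) (Icc r (r + ε) ×ˢ univ) ∧
      ContDiffOn ℝ n (fun p : ℝ × EuclideanSpace ℝ d => A p.1 p.2) (Icc (r - ε) r ×ˢ univ))
    (s : ℝ) (hAs : ContDiff ℝ ∞ (A s).symm) (n : ℕ) (a b : ℝ) :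
    ∃ C, ∀ t ∈ Icc a b, ∀ y, ‖iteratedFDeriv ℝ n (fun z => A t ((A s).symm z) - z) y‖ ≤ C := by
  have hper : ∀ t (z : EuclideanSpace ℝ d) (j : d), A t ((A s).symm (z + EuclideanSpace.single j 1)) - (z + EuclideanSpace.single j 1) =
      A t ((A s).symm z) - z := by
    intro t z j
    rw [← Torus.latticeVec_single, equivariant_symm (h1 s), h1]
    abel
  have slab : ∀ a' b' : ℝ, a' < b' → ContDiffOn ℝ ((max n 1 : ℕ) : ℕ∞) (fun p : ℝ × EuclideanSpace ℝ d => A p.1 p.2) (Icc a' b' ×ˢ univ) →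
      ∃ C, ∀ t ∈ Icc a' b', ∀ y, ‖iteratedFDeriv ℝ n (fun z => A t ((A s).symm z) - z) y‖ ≤ C := by
    intro a' b' hab h
    have hf : ContDiffOn ℝ ((max n 1 : ℕ) : ℕ∞) (fun p : ℝ × EuclideanSpace ℝ d => A p.1 ((A s).symm p.2) - p.2) (Icc a' b' ×ˢ univ) :=
      (h.comp (contDiffOn_fst.prodMk ((hAs.of_le (by exact_mod_cast le_top)).comp_contDiffOn contDiffOn_snd))
        fun p hp => ⟨hp.1, mem_univ _⟩).sub contDiffOn_snd
    exact exists_bound_iteratedFDeriv_slab (f := fun p : ℝ × EuclideanSpace ℝ d => A p.1 ((A s).symm p.2) - p.2) hab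
      (le_max_left n 1) hf fun t _ z j => hper t z j
  refine exists_bound_Icc_of_one_sided (w := fun t y => iteratedFDeriv ℝ n (fun z => A t ((A s).symm z) - z) y)
    (fun r => ?_) (fun r => ?_) a b
  · obtain ⟨ε, hε, hR, -⟩ := h3 (max n 1) (le_max_right _ _) r
    exact ⟨ε, hε, slab r (r + ε) (by linarith) hR⟩
  · obtain ⟨ε, hε, -, hL⟩ := h3 (max n 1) (le_max_right _ _) r
    exact ⟨ε, hε, slab (r - ε) r (by linarith) hL⟩

/-- **(L3b) for one level: the space derivatives of the lifted inserted level are bounded uniformly in time.** [folklore] -/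
theorem exists_bound_iteratedFDeriv_inserted (A : ℝ → EuclideanSpace ℝ d ≃ EuclideanSpace ℝ d)
    (h1 : ∀ t z (k : d → ℤ), A t (z + Torus.latticeVec k) = A t z + Torus.latticeVec k)
    (h3 : ∀ (n : ℕ), 1 ≤ n → ∀ r, ∃ ε > 0, ContDiffOn ℝ n (fun p : ℝ × EuclideanSpace ℝ d => A p.1 p.2) (Icc r (r + ε) ×ˢ univ) ∧
      ContDiffOn ℝ n (fun p : ℝ × EuclideanSpace ℝ d => A p.1 p.2) (Icc (r - ε) r ×ˢ univ))
    (h3' : ∀ (n : ℕ), 1 ≤ n → ∀ r, ∃ ε > 0, ContDiffOn ℝ n (fun p : ℝ × EuclideanSpace ℝ d => (A p.1).symm p.2) (Icc r (r + ε) ×ˢ univ) ∧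
      ContDiffOn ℝ n (fun p : ℝ × EuclideanSpace ℝ d => (A p.1).symm p.2) (Icc (r - ε) r ×ˢ univ))
    (hA : ∀ t, ContDiff ℝ ∞ (A t) ∧ ContDiff ℝ ∞ (A t).symm)
    (v : ℝ → EuclideanSpace ℝ d → EuclideanSpace ℝ d) (hvper : ∀ t z (k : d → ℤ), v t (z + Torus.latticeVec k) = v t z)
    (hvloc : ∀ (n : ℕ), 1 ≤ n → ∀ r, ∃ ε > 0, ContDiffOn ℝ n (uncurry v) (Icc r (r + ε) ×ˢ univ) ∧
      ContDiffOn ℝ n (uncurry v) (Icc (r - ε) r ×ˢ univ))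
    {R : ℝ} (hR : 0 < R) (hvan : ∀ (j : ℤ) z, v ((j : ℝ) * R) z = 0) {T : ℝ} (hT : 0 < T)
    (b : ℝ → EuclideanSpace ℝ d → EuclideanSpace ℝ d)
    (hb : ∀ t z, b t z = fderiv ℝ (fun y => A t ((A ((⌊t / R⌋ : ℝ) * R)).symm y)) (A ((⌊t / R⌋ : ℝ) * R) ((A t).symm z))
      (v t (A ((⌊t / R⌋ : ℝ) * R) ((A t).symm z))))
    (hbT : ∀ t z, b (t + T) z = b t z) (n : ℕ) :
    ∃ C, ∀ t y, ‖iteratedFDeriv ℝ n (b t) y‖ ≤ C := by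
  -- on a closed window the field is the window's fixed-frame formula (the Eulerian field vanishes at the right end)
  have key : ∀ (j : ℤ) t, t ∈ Icc ((j : ℝ) * R) (((j : ℝ) + 1) * R) → ∀ z,
      b t z = fderiv ℝ (fun y => A t ((A ((j : ℝ) * R)).symm y)) (A ((j : ℝ) * R) ((A t).symm z))
        (v t (A ((j : ℝ) * R) ((A t).symm z))) := by
    intro j t ht z
    rw [hb]
    rcases lt_or_eq_of_le ht.2 with hlt | heq
    · rw [floor_eq_of_mem_Ico hR ⟨ht.1, hlt⟩]
    · have hv0 : ∀ z, v t z = 0 := fun z => by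
        rw [heq, show ((j : ℝ) + 1) * R = ((j + 1 : ℤ) : ℝ) * R by push_cast; ring]; exact hvan _ z
      simp only [hv0, map_zero]
  -- a fixed-frame formula is bounded on any small closed slab where everything is jointly smooth
  have slab : ∀ (s a' b' : ℝ), a' < b' →
      ContDiffOn ℝ (n + 1) (fun p : ℝ × EuclideanSpace ℝ d => A p.1 p.2) (Icc a' b' ×ˢ univ) →
      ContDiffOn ℝ n (fun p : ℝ × EuclideanSpace ℝ d => (A p.1).symm p.2) (Icc a' b' ×ˢ univ) →
      ContDiffOn ℝ n (uncurry v) (Icc a' b' ×ˢ univ) →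
      ∃ C, ∀ t ∈ Icc a' b', ∀ y, ‖iteratedFDeriv ℝ n (fun z => fderiv ℝ (fun y => A t ((A s).symm y)) (A s ((A t).symm z))
        (v t (A s ((A t).symm z)))) y‖ ≤ C := by
    intro s a' b' hab hAj hA'j hvj
    have hf := contDiffOn_fixed_frame A hab s hAj hA'j (hA s).1 (hA s).2 v hvj
    exact exists_bound_iteratedFDeriv_slab (f := fun p : ℝ × EuclideanSpace ℝ d => fderiv ℝ (fun y => A p.1 ((A s).symm y))
      (A s ((A p.1).symm p.2)) (v p.1 (A s ((A p.1).symm p.2)))) hab le_rfl hf fun t _ z j => by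
        simp only []
        rw [← Torus.latticeVec_single]
        exact inserted_add_latticeVec A v t s h1 hvper z _
  -- hence `b` has bounded derivatives on `[0, T]`
  have hIcc : ∃ C, ∀ t ∈ Icc 0 T, ∀ y, ‖iteratedFDeriv ℝ n (b t) y‖ ≤ C := by
    refine exists_bound_Icc_of_one_sided (w := fun t y => iteratedFDeriv ℝ n (b t) y) (fun r => ?_) (fun r => ?_) 0 T
    · obtain ⟨ε₁, hε₁, hs₁⟩ := exists_Icc_right_subset_window hR r
      obtain ⟨ε₂, hε₂, hA2, -⟩ := h3 (n + 1) (by omega) r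
      obtain ⟨ε₃, hε₃, hA3, -⟩ := h3' (max n 1) (le_max_right _ _) r
      obtain ⟨ε₄, hε₄, hv4, -⟩ := hvloc (max n 1) (le_max_right _ _) r
      set ε := min (min ε₁ ε₂) (min ε₃ ε₄) with hε
      have hεpos : 0 < ε := lt_min (lt_min hε₁ hε₂) (lt_min hε₃ hε₄)
      have hε1 : ε ≤ ε₁ := le_trans (min_le_left _ _) (min_le_left _ _)
      have hε2 : ε ≤ ε₂ := le_trans (min_le_left _ _) (min_le_right _ _)
      have hε3 : ε ≤ ε₃ := le_trans (min_le_right _ _) (min_le_left _ _)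
      have hε4 : ε ≤ ε₄ := le_trans (min_le_right _ _) (min_le_right _ _)
      have hsub : ∀ {ε' : ℝ}, ε ≤ ε' → Icc r (r + ε) ×ˢ (univ : Set (EuclideanSpace ℝ d)) ⊆ Icc r (r + ε') ×ˢ univ :=
        fun h => prod_mono (Icc_subset_Icc le_rfl (by linarith)) le_rfl
      obtain ⟨C, hC⟩ := slab ((⌊r / R⌋ : ℝ) * R) r (r + ε) (by linarith) (hA2.mono (hsub hε2))
        ((hA3.mono (hsub hε3)).of_le (by exact_mod_cast le_max_left n 1)) ((hv4.mono (hsub hε4)).of_le (by exact_mod_cast le_max_left n 1))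
      refine ⟨ε, hεpos, C, fun t ht y => ?_⟩
      have hwin : t ∈ Icc ((⌊r / R⌋ : ℝ) * R) (((⌊r / R⌋ : ℝ) + 1) * R) := hs₁ ⟨ht.1, le_trans ht.2 (by linarith)⟩
      have e : b t = fun z => fderiv ℝ (fun y => A t ((A ((⌊r / R⌋ : ℝ) * R)).symm y)) (A ((⌊r / R⌋ : ℝ) * R) ((A t).symm z))
          (v t (A ((⌊r / R⌋ : ℝ) * R) ((A t).symm z))) := funext fun z => key _ t hwin z
      simp only [e]
      exact hC t ht y
    · obtain ⟨ε₁, hε₁, hs₁⟩ := exists_Icc_left_subset_window hR r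
      obtain ⟨ε₂, hε₂, -, hA2⟩ := h3 (n + 1) (by omega) r
      obtain ⟨ε₃, hε₃, -, hA3⟩ := h3' (max n 1) (le_max_right _ _) r
      obtain ⟨ε₄, hε₄, -, hv4⟩ := hvloc (max n 1) (le_max_right _ _) r
      set ε := min (min ε₁ ε₂) (min ε₃ ε₄) with hε
      have hεpos : 0 < ε := lt_min (lt_min hε₁ hε₂) (lt_min hε₃ hε₄)
      have hε1 : ε ≤ ε₁ := le_trans (min_le_left _ _) (min_le_left _ _)
      have hε2 : ε ≤ ε₂ := le_trans (min_le_left _ _) (min_le_right _ _)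
      have hε3 : ε ≤ ε₃ := le_trans (min_le_right _ _) (min_le_left _ _)
      have hε4 : ε ≤ ε₄ := le_trans (min_le_right _ _) (min_le_right _ _)
      have hsub : ∀ {ε' : ℝ}, ε ≤ ε' → Icc (r - ε) r ×ˢ (univ : Set (EuclideanSpace ℝ d)) ⊆ Icc (r - ε') r ×ˢ univ :=
        fun h => prod_mono (Icc_subset_Icc (by linarith) le_rfl) le_rfl
      set j : ℤ := ⌈r / R⌉ - 1 with hj
      obtain ⟨C, hC⟩ := slab ((j : ℝ) * R) (r - ε) r (by linarith) (hA2.mono (hsub hε2))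
        ((hA3.mono (hsub hε3)).of_le (by exact_mod_cast le_max_left n 1)) ((hv4.mono (hsub hε4)).of_le (by exact_mod_cast le_max_left n 1))
      refine ⟨ε, hεpos, C, fun t ht y => ?_⟩
      have hwin : t ∈ Icc ((j : ℝ) * R) (((j : ℝ) + 1) * R) := by
        have h := hs₁ ⟨le_trans (by linarith) ht.1, ht.2⟩
        exact_mod_cast h
      have e : b t = fun z => fderiv ℝ (fun y => A t ((A ((j : ℝ) * R)).symm y)) (A ((j : ℝ) * R) ((A t).symm z))
          (v t (A ((j : ℝ) * R) ((A t).symm z))) := funext fun z => key j t hwin z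
      simp only [e]
      exact hC t ht y
  -- and everywhere, by periodicity
  obtain ⟨C, hC⟩ := hIcc
  refine ⟨C, fun t y => ?_⟩
  have hper : ∀ z, Function.Periodic (fun t => b t z) T := fun z t => hbT t z
  set k : ℤ := ⌊t / T⌋ with hk
  have ht0 : t - k * T ∈ Icc 0 T := by
    have h1 := Int.floor_le (t / T)
    have h2 := Int.lt_floor_add_one (t / T)
    constructor
    · have : (k : ℝ) * T ≤ t := (le_div_iff₀ hT).mp h1
      linarith
    · have : t < ((k : ℝ) + 1) * T := (div_lt_iff₀ hT).mp h2
      linarith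
  have e : b t = b (t - k * T) := funext fun z => ((hper z).sub_int_mul_eq k).symm
  rw [e]
  exact hC _ ht0 y

end Summit.AnomalousDissipation.AnomalousDissipation.Theorems.SolenoidalFractalHomogenisation.LagrangianCarrierConstruction

end
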